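import Mathlib
import Literature.NumberTheory.LFunctions.Zhang2022.TypedSection16A
import Literature.NumberTheory.LFunctions.Zhang2022.TypedSection15AIdentities
import Literature.NumberTheory.LFunctions.Zhang2022.TypedSection16ALeaves
import HarnessLib

/-!
# Zhang (2022) §16, (16.4): "the innermost sum is, by the Mellin transform, equal to
# `(1/2πi)∫_{(2)} (Σ_{(l₁,d₂k)=1} κ₂(d₁l₁)χ(l₁)/l₁^s)(Dpk/l₂)^s δ(s) ds`" — DISCHARGED
# (with §16.u011, the regrouping "similar to (7.17)" that precedes it)

Topic `Literature/NumberTheory/LFunctions/Zhang2022` (Landau–Siegel audit tree; verdict-neutral).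
Y. Zhang, *Discrete mean estimates and the Landau–Siegel zero*, arXiv:2211.02515v1 (2022)
[Zhang2022LandauSiegel] — **an unrefereed manuscript under adjudication** (ZHANG-L discharge lane;
DAG node `Z22:(16.4)` [Z22 p.90, (16.4), tex L4466], typed AS PRINTED as
`Typed.Section16A.Eq16_4` in `Zhang2022/TypedSection16A.lean`).

This theorem-only leaf proves two things.

* `tsum_mul_DeltaW_eq_integral` — the GENERIC "by the Mellin transform" step for Zhang's weight `Δ`
  ((5.7), `Skeleton.DeltaW`) and its Mellin transform `δ` ((5.14), `Skeleton.deltaW`) on the line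
  `σ = 2`: for every modulus `D ≥ 3`, every `X > 0` and every coefficient sequence `a : ℕ → ℂ` with
  `a 0 = 0` and `Σ_l |a(l)| l⁻² < ∞`,
  `Σ_l a(l)Δ(l/X) = (1/2πi)∫_{(2)} (Σ_l a(l)l^{−s}) X^s δ(s) ds`
  (written in the tree's house style `(1/(2π))∫_ℝ F(2+it) dt`). Proof: Mellin inversion of `Δ` on
  `σ = 2` termwise (`Typed.Section15A.DeltaW_eq_mellinInv_two`, from Mathlib's `mellinInv_mellin_eq`
  and Lemma 5.4 (i), `Typed.Section15A.integrable_deltaW_line_two`), `(l/X)^{−s} = X^s/l^s`, and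
  the interchange `Σ_l ∫_t = ∫_t Σ_l` by `MeasureTheory.integral_tsum_of_summable_integral_norm`,
  the `L¹` norms being dominated by `|a(l)|l⁻² · X² · ∫|δ(2+it)|dt`. This is the common parent of the
  manuscript's displays (7.19), (15.8) and (16.4) (the first two are already tree theorems,
  `Section7dStatements.eq719_holds` and `Typed.Section15A.eq15_8_holds`, proved ad hoc).
* `eq16_4_holds : Typed.Section16A.Eq16_4 c'` for every `c′` — **node `Z22:(16.4)` DISCHARGED**
  (`D ≥ 3`, every `p ∼ P`, `d₁, d₂, k, l₂ ≥ 1`): the instance `a(l₁) = κ₂(d₁l₁)χ(l₁)·[(l₁,d₂k)=1]`,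
  `X = Dpk/l₂`, whose summability comes from `|κ₂(n)| ≤ τ₂(n) ≤ τ₃(n)` (`κ₂ = n^{−β₁} ∗ μ` with
  `β₁ ∈ iℝ`, the tree's `MeanSquareMajorant.kappa₂`) and `Σ τ₃(n)n⁻² < ∞`
  (`Typed.Section15A.summable_tau_three_div_sq`).
* `tsum_conv_mul_DeltaW_regroup` — the GENERIC regrouping behind §15.u019 / §16.u011 ("similar to
  (7.17)"): for `D ≥ 3`, any arithmetic function `κ` with `|κ(n)| ≤ τ₃(n)`, any finitely supported
  `b : ℕ → ℂ` with `b(0) = 0`, any `R > 0`, `d ≥ 1` and `k`,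
  `Σ_{(l,k)=1} (κ∗b)(dl)χ(l)Δ(l/R) = Σ_{d=d₁d₂} Σ_{(l₂,k)=1} b(d₂l₂)χ(l₂) Σ_{(l₁,d₂k)=1} κ(d₁l₁)χ(l₁)Δ(l₁l₂/R)`
  — the termwise regrouping `Typed.Section15A.sum_divisorsAntidiagonal_mul_regroup` and the
  rearrangement of the absolutely convergent double series over `(l₁, l₂)` (`|Δ(x)| ≤ C_Δx⁻²`,
  `Typed.Section15A.norm_DeltaW_le_div_sq`), exactly as in the tree's `step15_u019_of_support`.
* `step16_u011_holds : Typed.Section16A.Step16_u011 c'` for every `c′` — **node `Z22:§16.u011`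
  DISCHARGED** (`D ≥ ⌈e¹⁰⌉`, every `p ∼ P`, `d, k ≥ 1`): the instance `κ = κ₂`, `b = b₁`
  (`Typed.Section16A.b1coef`, supported below `2PT⁻⁸ ≤ P` once `𝓛 ≥ 10`:
  `Typed.Section16ALeaves.b1coef_eq_zero_of_le`, `suppBound_le_bigP`), `R = Dpk`; the printed finite
  `l₂`-range `[1, ⌈P⌉)` is faithful to the series by that support bound.

No new definitions, no named facts, no `sorry`; (A) is not used. Nothing here bears on the later
steps of §16 (u015: the contour shift to `s = ρ̃`), on Theorems 1–2 of the source, or on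
Landau–Siegel zeros.

## References

* Y. Zhang, arXiv:2211.02515v1 (2022), §16 (16.4) p. 90, tex L4466, u011 p. 89, tex L4460; §5 (5.7),
  (5.14), Lemma 5.4 (i) p. 28; §15 (15.8) p. 82; §7 (7.17) p. 39, (7.19) p. 40.
  [cite: Zhang2022LandauSiegel, §16 (16.4) p.90]
-/

noncomputable section

open Complex Real MeasureTheory
open Literature.NumberTheory.LFunctions.Zhang2022
open Literature.NumberTheory.LFunctions.Zhang2022.Skeleton

namespace Literature.NumberTheory.LFunctions.Zhang2022.Typed.Section16A

/-! ## The generic Mellin step for `Δ` on `σ = 2` -/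

section Generic

/-- `(a/X)^{−s} = X^s/a^s` for `a, X > 0` (real bases, complex exponent). [folklore] -/
private theorem cpow_neg_div_eq {a X : ℝ} (ha : 0 < a) (hX : 0 < X) (s : ℂ) :
    (((a / X : ℝ)) : ℂ) ^ (-s) = (X : ℂ) ^ s / (a : ℂ) ^ s := by
  have elog : ∀ {y : ℝ}, 0 < y → ∀ w : ℂ, (y : ℂ) ^ w = Complex.exp ((Real.log y : ℂ) * w) :=
    fun {y} hy w => by
      rw [Complex.cpow_def_of_ne_zero (Complex.ofReal_ne_zero.mpr hy.ne'), ← Complex.ofReal_log hy.le]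
  rw [elog (div_pos ha hX), elog hX, elog ha, Real.log_div ha.ne' hX.ne', ← Complex.exp_sub]
  congr 1
  push_cast
  ring

/-- **The Mellin step for `Δ` on `σ = 2`, generic coefficients.** For `D ≥ 3`, `X > 0` and
`a : ℕ → ℂ` with `a(0) = 0` and `Σ_l |a(l)|l⁻² < ∞`:
`Σ_l a(l)Δ(l/X) = (1/2π)∫_ℝ (Σ_l a(l)l^{−(2+it)}) X^{2+it} δ(2+it) dt`, i.e.
`= (1/2πi)∫_{(2)} (Σ_l a(l)l^{−s}) X^s δ(s) ds` — Mellin inversion of `Δ` termwise and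
`Σ_l∫ = ∫Σ_l` by dominated convergence. [cite: Zhang2022LandauSiegel, §16 (16.4) p.90; §5 (5.14)] -/
theorem tsum_mul_DeltaW_eq_integral {D : ℕ} (hD : 3 ≤ D) {a : ℕ → ℂ} (h0 : a 0 = 0)
    (ha : Summable fun l : ℕ => ‖a l‖ / (l : ℝ) ^ 2) {X : ℝ} (hX0 : 0 < X) :
    ∑' l : ℕ, a l * DeltaW D ((l : ℝ) / X) =
      (1 / (2 * π) : ℂ) * ∫ t : ℝ,
        (∑' l : ℕ, a l / (l : ℂ) ^ (2 + t * I : ℂ)) * (X : ℂ) ^ (2 + t * I : ℂ) *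
          deltaW D (2 + t * I) := by
  have hδi := Typed.Section15A.integrable_deltaW_line_two hD
  have hδc := Typed.Section15A.continuous_deltaW_line_two hD
  -- the pieces of the integrand
  set G : ℝ → ℂ := fun t => (X : ℂ) ^ (2 + t * I) * deltaW D (2 + t * I) with hG
  set f : ℕ → ℝ → ℂ := fun l t => a l / (l : ℂ) ^ (2 + t * I : ℂ) with hf
  set F : ℕ → ℝ → ℂ := fun l t => f l t * G t with hF
  have hs : Measurable fun t : ℝ => (2 : ℂ) + t * I := by fun_prop
  have hGn : ∀ t : ℝ, ‖G t‖ = X ^ 2 * ‖deltaW D (2 + t * I)‖ := fun t => by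
    simp only [hG]
    rw [norm_mul, Complex.norm_cpow_eq_rpow_re_of_pos hX0]
    simp
  have hfn : ∀ (l : ℕ) (t : ℝ), ‖f l t‖ ≤ ‖a l‖ / (l : ℝ) ^ 2 := by
    intro l t
    simp only [hf]
    rcases Nat.eq_zero_or_pos l with rfl | hl
    · rw [h0]; simp
    · rw [norm_div, Complex.norm_natCast_cpow_of_pos hl]
      simp only [Complex.add_re, Complex.re_ofNat, Complex.mul_re, Complex.ofReal_re,
        Complex.I_re, mul_zero, Complex.ofReal_im, Complex.I_im, mul_one, sub_self, add_zero,
        Real.rpow_two]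
      exact le_rfl
  -- each term is integrable in `t`
  have hFm : ∀ l : ℕ, AEStronglyMeasurable (F l) := by
    intro l
    have h1 : Measurable fun t : ℝ => f l t := by
      simp only [hf]
      exact measurable_const.div (measurable_const.pow hs)
    have h2 : Measurable G := by
      simp only [hG]
      exact (measurable_const.pow hs).mul hδc.measurable
    exact (h1.mul h2).aestronglyMeasurable
  have hFn : ∀ (l : ℕ) (t : ℝ), ‖F l t‖ ≤
      ‖a l‖ / (l : ℝ) ^ 2 * X ^ 2 * ‖deltaW D (2 + t * I)‖ := by
    intro l t
    simp only [hF]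
    rw [norm_mul, hGn]
    calc ‖f l t‖ * (X ^ 2 * ‖deltaW D (2 + t * I)‖)
        ≤ ‖a l‖ / (l : ℝ) ^ 2 * (X ^ 2 * ‖deltaW D (2 + t * I)‖) :=
          mul_le_mul_of_nonneg_right (hfn l t) (by positivity)
      _ = _ := by ring
  have hFi : ∀ l : ℕ, Integrable (F l) := fun l =>
    Integrable.mono' (hδi.norm.const_mul (‖a l‖ / (l : ℝ) ^ 2 * X ^ 2))
      (hFm l) (Filter.Eventually.of_forall fun t => hFn l t)
  -- the sum of the `L¹` norms converges
  have hFs : Summable fun l : ℕ => ∫ t : ℝ, ‖F l t‖ := by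
    set Iδ : ℝ := ∫ t : ℝ, ‖deltaW D (2 + t * I)‖ with hIδ
    have hmaj : Summable fun l : ℕ => ‖a l‖ / (l : ℝ) ^ 2 * X ^ 2 * Iδ := by
      have h2 : ∀ l : ℕ, ‖a l‖ / (l : ℝ) ^ 2 * X ^ 2 * Iδ = (X ^ 2 * Iδ) * (‖a l‖ / (l : ℝ) ^ 2) :=
        fun l => by ring
      simp_rw [h2]
      exact ha.mul_left _
    refine Summable.of_nonneg_of_le (fun l => integral_nonneg fun t => norm_nonneg _)
      (fun l => ?_) hmaj
    calc ∫ t : ℝ, ‖F l t‖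
        ≤ ∫ t : ℝ, ‖a l‖ / (l : ℝ) ^ 2 * X ^ 2 * ‖deltaW D (2 + t * I)‖ :=
          integral_mono (hFi l).norm (hδi.norm.const_mul _) fun t => hFn l t
      _ = ‖a l‖ / (l : ℝ) ^ 2 * X ^ 2 * Iδ := integral_const_mul _ _
  -- termwise: Mellin inversion
  have hterm : ∀ l : ℕ, a l * DeltaW D ((l : ℝ) / X) = (1 / (2 * π) : ℂ) * ∫ t : ℝ, F l t := by
    intro l
    rcases Nat.eq_zero_or_pos l with rfl | hl
    · have hF0 : F 0 = fun _ => 0 := by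
        funext t; simp only [hF, hf, h0]; simp
      rw [h0, hF0]; simp
    · have hx : 0 < (l : ℝ) / X := by positivity
      rw [Typed.Section15A.DeltaW_eq_mellinInv_two hD hx, ← mul_assoc,
        mul_comm (a l) (1 / (2 * π) : ℂ), mul_assoc, ← integral_const_mul]
      congr 1
      refine integral_congr_ae (Filter.Eventually.of_forall fun t => ?_)
      simp only [hF, hf, hG]
      rw [cpow_neg_div_eq (by exact_mod_cast hl) hX0, Complex.ofReal_natCast]
      ring
  -- assemble
  calc (∑' l : ℕ, a l * DeltaW D ((l : ℝ) / X))
      = ∑' l : ℕ, (1 / (2 * π) : ℂ) * ∫ t : ℝ, F l t := tsum_congr hterm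
    _ = (1 / (2 * π) : ℂ) * ∑' l : ℕ, ∫ t : ℝ, F l t := tsum_mul_left
    _ = (1 / (2 * π) : ℂ) * ∫ t : ℝ, ∑' l : ℕ, F l t := by
        rw [integral_tsum_of_summable_integral_norm hFi hFs]
    _ = (1 / (2 * π) : ℂ) * ∫ t : ℝ,
          (∑' l : ℕ, a l / (l : ℂ) ^ (2 + t * I : ℂ)) * (X : ℂ) ^ (2 + t * I : ℂ) *
            deltaW D (2 + t * I) := by
        congr 1
        refine integral_congr_ae (Filter.Eventually.of_forall fun t => ?_)
        simp only [hF, hG, hf]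
        rw [tsum_mul_right, mul_assoc]

end Generic

/-! ## `|κ₂(n)| ≤ τ₃(n)` and the summability of the (16.4) coefficients -/

section Kappa2

/-- Termwise majorants multiply under Dirichlet convolution. [folklore] -/
private theorem norm_mul_apply_le' {f g : ArithmeticFunction ℂ} {F G : ArithmeticFunction ℝ}
    (hf : ∀ n, ‖f n‖ ≤ F n) (hg : ∀ n, ‖g n‖ ≤ G n) (n : ℕ) : ‖(f * g) n‖ ≤ (F * G) n := by
  rw [ArithmeticFunction.mul_apply, ArithmeticFunction.mul_apply]
  refine (norm_sum_le _ _).trans (Finset.sum_le_sum fun x _ => ?_)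
  rw [norm_mul]
  exact mul_le_mul (hf _) (hg _) (norm_nonneg _) ((norm_nonneg _).trans (hf _))

/-- `|n^{−ib}| ≤ ζ(n)` (`= 1` for `n ≥ 1`, `0` at `0`). [folklore] -/
private theorem norm_powI_le_zeta' (b : ℝ) (n : ℕ) :
    ‖MeanSquareMajorant.powI b n‖ ≤ (ArithmeticFunction.zeta : ArithmeticFunction ℝ) n := by
  rcases Nat.eq_zero_or_pos n with rfl | hn
  · simp
  · rw [MeanSquareMajorant.norm_powI_of_pos b hn, ArithmeticFunction.natCoe_apply,
      ArithmeticFunction.zeta_apply_ne hn.ne']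
    simp

/-- `|μ(n)| ≤ ζ(n)`. [folklore] -/
private theorem norm_moebius_le_zeta' (n : ℕ) :
    ‖(ArithmeticFunction.moebius : ArithmeticFunction ℂ) n‖ ≤
      (ArithmeticFunction.zeta : ArithmeticFunction ℝ) n := by
  rcases Nat.eq_zero_or_pos n with rfl | hn
  · simp
  · rw [ArithmeticFunction.intCoe_apply, ArithmeticFunction.natCoe_apply,
      ArithmeticFunction.zeta_apply_ne hn.ne', Complex.norm_intCast]
    exact_mod_cast ArithmeticFunction.abs_moebius_le_one

/-- **`|κ₂(n)| ≤ τ₂(n)`** (`κ₂ = n^{−β₁} ∗ μ`, `β₁ = ib₁`: both factors bounded by `ζ` termwise;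
§16's `κ₂` is the tree's `MeanSquareMajorant.kappa₂ (b₁ c′ D)`). [cite: Zhang2022LandauSiegel, §16 p.89 (u006)] -/
theorem norm_kappa2_le_tau_two (c' : ℝ) (D n : ℕ) :
    ‖kappa2 c' D n‖ ≤ MeanSquareMajorant.tau 2 n := by
  have h : MeanSquareMajorant.tau 2 =
      (ArithmeticFunction.zeta : ArithmeticFunction ℝ) * ArithmeticFunction.zeta := by
    rw [MeanSquareMajorant.tau, pow_two]
  rw [h, kappa2, MeanSquareMajorant.kappa₂]
  exact norm_mul_apply_le' (norm_powI_le_zeta' _) norm_moebius_le_zeta' n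

/-- `τ₂(n) ≤ τ₃(n)` (`τ₃(n) = Σ_{d∣n} τ₂(d)` contains the term `d = n`). [folklore] -/
private theorem tau_two_le_tau_three (n : ℕ) : MeanSquareMajorant.tau 2 n ≤ MeanSquareMajorant.tau 3 n := by
  rcases Nat.eq_zero_or_pos n with rfl | hn
  · simp
  · rw [MeanSquareMajorant.tau_succ_apply 2 n]
    exact Finset.single_le_sum (fun d _ => MeanSquareMajorant.tau_nonneg 2 d)
      (Nat.mem_divisors_self n hn.ne')

/-- **`|κ₂(n)| ≤ τ₃(n)`** (the majorant in the shape used by the (15.8) machinery).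
[cite: Zhang2022LandauSiegel, §16 p.89 (u006)] -/
theorem norm_kappa2_le_tau_three (c' : ℝ) (D n : ℕ) :
    ‖kappa2 c' D n‖ ≤ MeanSquareMajorant.tau 3 n :=
  (norm_kappa2_le_tau_two c' D n).trans (tau_two_le_tau_three n)

/-- **`Σ_l τ₃(d₁l) l⁻² < ∞`** for `d₁ ≥ 1` (a rescaled sub-series of `Σ_n τ₃(n)n⁻²`,
`Typed.Section15A.summable_tau_three_div_sq`). [cite: HardyWright2008, Theorem 315] -/
theorem summable_tau_three_mul_div_sq {d₁ : ℕ} (hd₁ : 0 < d₁) :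
    Summable fun l : ℕ => MeanSquareMajorant.tau 3 (d₁ * l) / (l : ℝ) ^ 2 := by
  have h1 : Summable fun l : ℕ =>
      MeanSquareMajorant.tau 3 (d₁ * l) / ((d₁ * l : ℕ) : ℝ) ^ 2 :=
    Typed.Section15A.summable_tau_three_div_sq.comp_injective (mul_right_injective₀ hd₁.ne')
  have h2 : ∀ l : ℕ, MeanSquareMajorant.tau 3 (d₁ * l) / (l : ℝ) ^ 2 =
      (d₁ : ℝ) ^ 2 * (MeanSquareMajorant.tau 3 (d₁ * l) / ((d₁ * l : ℕ) : ℝ) ^ 2) := by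
    intro l
    rcases Nat.eq_zero_or_pos l with rfl | hl
    · simp
    · have hl' : (l : ℝ) ≠ 0 := by positivity
      have hd' : (d₁ : ℝ) ≠ 0 := by positivity
      push_cast
      field_simp
  simp_rw [h2]
  exact h1.mul_left _

end Kappa2

/-! ## (16.4) -/

section Eq164

/-- **`Z22:(16.4)` DISCHARGED** (`D ≥ 3`, all `p ∼ P`, `d₁, d₂, k, l₂ ≥ 1`): "The innermost sum is,
by the Mellin transform, equal to `(1/2πi)∫_{(2)} (Σ_{(l₁,d₂k)=1} κ₂(d₁l₁)χ(l₁)/l₁^s)(Dpk/l₂)^s δ(s) ds`"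
— the generic step `tsum_mul_DeltaW_eq_integral` at `a(l₁) = κ₂(d₁l₁)χ(l₁)·[(l₁,d₂k) = 1]`,
`X = Dpk/l₂` (`Σ_{l₁}|a(l₁)|l₁⁻² ≤ Σ τ₃(d₁l₁)l₁⁻² < ∞`). [cite: Zhang2022LandauSiegel, §16 (16.4) p.90] -/
theorem eq16_4_holds (c' : ℝ) : Eq16_4 c' := by
  refine ⟨3, fun D _ χ hD _ _ => ?_⟩
  intro p hp d₁ d₂ k l₂ hd₁ hd₂ hk hl₂
  have hp0 : 0 < p := (Finset.mem_filter.mp hp).2.pos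
  have hD0 : 0 < D := by omega
  have hd₁0 : 0 < d₁ := hd₁
  have hDr : (D : ℝ) ≠ 0 := by positivity
  have hpr : (p : ℝ) ≠ 0 := by positivity
  have hkr : (k : ℝ) ≠ 0 := by positivity
  have hl₂r : (l₂ : ℝ) ≠ 0 := by positivity
  set X : ℝ := (D : ℝ) * p * k / l₂ with hX
  have hX0 : 0 < X := by rw [hX]; positivity
  -- the coefficient sequence
  set a : ℕ → ℂ := fun l₁ => if Nat.Coprime l₁ (d₂ * k) then
      kappa2 c' D (d₁ * l₁) * χ (l₁ : ZMod D) else 0 with ha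
  have hκ0 : kappa2 c' D (d₁ * 0) = 0 := by
    rw [mul_zero, kappa2]; exact ArithmeticFunction.map_zero
  have h0 : a 0 = 0 := by
    simp only [ha]
    split_ifs
    · rw [hκ0, zero_mul]
    · rfl
  have han : ∀ l₁ : ℕ, ‖a l₁‖ ≤ MeanSquareMajorant.tau 3 (d₁ * l₁) := by
    intro l₁
    simp only [ha]
    by_cases hc : Nat.Coprime l₁ (d₂ * k)
    · rw [if_pos hc, norm_mul]
      calc ‖kappa2 c' D (d₁ * l₁)‖ * ‖χ (l₁ : ZMod D)‖
          ≤ MeanSquareMajorant.tau 3 (d₁ * l₁) * 1 :=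
            mul_le_mul (norm_kappa2_le_tau_three c' D _) (DirichletCharacter.norm_le_one χ _)
              (norm_nonneg _) (MeanSquareMajorant.tau_nonneg _ _)
        _ = MeanSquareMajorant.tau 3 (d₁ * l₁) := mul_one _
    · rw [if_neg hc, norm_zero]
      exact MeanSquareMajorant.tau_nonneg _ _
  have hsum : Summable fun l₁ : ℕ => ‖a l₁‖ / (l₁ : ℝ) ^ 2 :=
    Summable.of_nonneg_of_le (fun l₁ => div_nonneg (norm_nonneg _) (sq_nonneg _))
      (fun l₁ => div_le_div_of_nonneg_right (han l₁) (sq_nonneg _))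
      (summable_tau_three_mul_div_sq hd₁0)
  have key := tsum_mul_DeltaW_eq_integral hD h0 hsum hX0
  -- the left sides agree termwise
  have hL : ∀ l₁ : ℕ, (if Nat.Coprime l₁ (d₂ * k) then
        kappa2 c' D (d₁ * l₁) * χ (l₁ : ZMod D) *
          DeltaW D (((l₁ * l₂ : ℕ) : ℝ) / ((D : ℝ) * p * k))
      else 0) = a l₁ * DeltaW D ((l₁ : ℝ) / X) := by
    intro l₁
    have hxX : ((l₁ * l₂ : ℕ) : ℝ) / ((D : ℝ) * p * k) = (l₁ : ℝ) / X := by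
      rw [hX]; push_cast; field_simp
    simp only [ha]
    by_cases hc : Nat.Coprime l₁ (d₂ * k)
    · rw [if_pos hc, if_pos hc, hxX]
    · rw [if_neg hc, if_neg hc, zero_mul]
  -- the right sides agree pointwise in `t`
  have hR : ∀ t : ℝ, integrand16_4 c' χ d₁ (d₂ * k) X (2 + t * I) =
      (∑' l₁ : ℕ, a l₁ / (l₁ : ℂ) ^ (2 + t * I : ℂ)) * (X : ℂ) ^ (2 + t * I : ℂ) *
        deltaW D (2 + t * I) := by
    intro t
    rw [integrand16_4, kap2Ser]
    congr 2
    refine tsum_congr fun l₁ => ?_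
    simp only [ha]
    by_cases hc : Nat.Coprime l₁ (d₂ * k)
    · rw [if_pos hc, if_pos hc]
    · rw [if_neg hc, if_neg hc, zero_div]
  rw [tsum_congr hL, key]
  congr 1
  exact integral_congr_ae (Filter.Eventually.of_forall fun t => (hR t).symm)

variable (c' : ℝ) in
/-- `Eq16_4` — `_holds` alias of `eq16_4_holds` above under the fact's exact name, stated under the
prover's own binders as section variables (appended 2026-08-28, D-0026 bookkeeping: the proof term is the
existing theorem of this file; no statement, definition or attribute is edited; no new named fact; the
ledger's debt table listed the fact unproved). [cite: Zhang2022LandauSiegel, §16 (16.4) p.90] -/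
theorem _root_.Literature.NumberTheory.LFunctions.Zhang2022.Typed.Section16A.Eq16_4_holds :
    _root_.Literature.NumberTheory.LFunctions.Zhang2022.Typed.Section16A.Eq16_4 c' :=
  _root_.Literature.NumberTheory.LFunctions.Zhang2022.Typed.Section16A.eq16_4_holds (c' := c')

end Eq164

/-! ## §16.u011: the regrouping of `Σ_{(l,k)=1}(κ₂∗b₁)(dl)χ(l)Δ(l/(Dpk))` ("similar to (7.17)") -/

section U011

/-- The fibres of `(l₁,l₂) ↦ l₁l₂`: a summable double series vanishing on the axes sums, grouped
by the product, to its total (`HasSum.tsum_fiberwise`; the fibre over `l ≥ 1` is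
`Nat.divisorsAntidiagonal l`, the fibre over `0` carries only zero terms). [folklore] -/
private theorem hasSum_sum_divisorsAntidiagonal {g : ℕ × ℕ → ℂ} (hg : Summable g)
    (h0 : ∀ q : ℕ × ℕ, q.1 = 0 ∨ q.2 = 0 → g q = 0) :
    HasSum (fun l : ℕ => ∑ q ∈ l.divisorsAntidiagonal, g q) (∑' q : ℕ × ℕ, g q) := by
  have h := hg.hasSum.tsum_fiberwise (fun q : ℕ × ℕ => q.1 * q.2)
  have heq : (fun l : ℕ => ∑ q ∈ l.divisorsAntidiagonal, g q) =
      fun l : ℕ => ∑' b : ((fun q : ℕ × ℕ => q.1 * q.2) ⁻¹' {l}), g b.val := by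
    funext l
    rcases eq_or_ne l 0 with rfl | hl
    · rw [Nat.divisorsAntidiagonal_zero, Finset.sum_empty]
      have hz : ∀ b : ((fun q : ℕ × ℕ => q.1 * q.2) ⁻¹' {0}), g b.val = 0 := by
        rintro ⟨⟨a, c⟩, hb⟩
        simp only [Set.mem_preimage, Set.mem_singleton_iff, Nat.mul_eq_zero] at hb
        exact h0 (a, c) hb
      symm
      calc ∑' b : ((fun q : ℕ × ℕ => q.1 * q.2) ⁻¹' {0}), g b.val
          = ∑' _ : ((fun q : ℕ × ℕ => q.1 * q.2) ⁻¹' {0}), (0 : ℂ) := tsum_congr hz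
        _ = 0 := tsum_zero
    · rw [show ((fun q : ℕ × ℕ => q.1 * q.2) ⁻¹' {l}) = ↑(l.divisorsAntidiagonal) by
          ext q; simp [hl], Finset.tsum_subtype']
  rw [heq]
  exact h

/-- **The regrouping "similar to (7.17)", generic coefficients.** For `D ≥ 3`, a character `χ`
mod `D`, an arithmetic function `κ` with `|κ(n)| ≤ τ₃(n)`, a finitely supported `b : ℕ → ℂ` with
`b(0) = 0`, `R > 0`, `d ≥ 1` and any `k`:
`Σ_{(l,k)=1} (κ∗b)(dl)χ(l)Δ(l/R) = Σ_{d=d₁d₂} Σ_{(l₂,k)=1} b(d₂l₂)χ(l₂) Σ_{(l₁,d₂k)=1} κ(d₁l₁)χ(l₁)Δ(l₁l₂/R)`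
— `(κ∗b)(dl) = Σ_{d=d₁d₂}Σ_{l=l₁l₂,(l₁,d₂)=1} b(d₂l₂)κ(d₁l₁)` termwise, then the rearrangement of
the absolutely convergent double series over `(l₁,l₂)` (`|κ(d₁l₁)| ≤ τ₃(d₁l₁)`, `|Δ(x)| ≤ C_Δx⁻²`,
`Σ τ₃(n)n⁻² < ∞`, `b` of finite support). [cite: Zhang2022LandauSiegel, §7 (7.17) p.39; §16 p.89 (u011)] -/
theorem tsum_conv_mul_DeltaW_regroup {D : ℕ} (hD : 3 ≤ D) (χ : DirichletCharacter ℂ D)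
    (κ : ArithmeticFunction ℂ) (hκ : ∀ n, ‖κ n‖ ≤ MeanSquareMajorant.tau 3 n)
    (b : ℕ → ℂ) (hb0 : b 0 = 0) {N : ℕ} (hN : ∀ n : ℕ, N ≤ n → b n = 0)
    {R : ℝ} (hR0 : 0 < R) {d : ℕ} (hd : 0 < d) (k : ℕ) :
    (∑' l : ℕ, if Nat.Coprime l k then
        MeanSquareMajorant.conv κ b (d * l) * χ (l : ZMod D) * DeltaW D ((l : ℝ) / R) else 0) =
      ∑ dd ∈ d.divisorsAntidiagonal,
        ∑' l₂ : ℕ, if Nat.Coprime l₂ k then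
          b (dd.2 * l₂) * χ (l₂ : ZMod D) *
            ∑' l₁ : ℕ, (if Nat.Coprime l₁ (dd.2 * k) then
              κ (dd.1 * l₁) * χ (l₁ : ZMod D) * DeltaW D (((l₁ * l₂ : ℕ) : ℝ) / R)
            else 0)
        else 0 := by
  obtain ⟨CΔ, hCΔ0, hCΔ⟩ := Typed.Section15A.norm_DeltaW_le_div_sq hD
  -- the double series, one for each factorisation `d = d₁d₂`
  set A : ℕ × ℕ → ℕ → ℂ := fun dd l₁ =>
    if Nat.Coprime l₁ (dd.2 * k) then κ (dd.1 * l₁) * χ (l₁ : ZMod D) else 0 with hA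
  set B : ℕ × ℕ → ℕ → ℂ := fun dd l₂ =>
    if Nat.Coprime l₂ k then b (dd.2 * l₂) * χ (l₂ : ZMod D) else 0 with hB
  set g : ℕ × ℕ → ℕ × ℕ → ℂ := fun dd q =>
    A dd q.1 * B dd q.2 * DeltaW D (((q.1 * q.2 : ℕ) : ℝ) / R) with hg
  have hA0 : ∀ dd, A dd 0 = 0 := fun dd => by
    simp only [hA]; split_ifs <;> simp
  have hB0 : ∀ dd, B dd 0 = 0 := fun dd => by
    simp only [hB]; split_ifs <;> simp [hb0]
  have hg0 : ∀ dd (q : ℕ × ℕ), q.1 = 0 ∨ q.2 = 0 → g dd q = 0 := by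
    rintro dd ⟨q1, q2⟩ (h | h) <;> simp only at h <;> subst h <;> simp only [hg, hA0, hB0] <;> simp
  have hAn : ∀ dd l₁, ‖A dd l₁‖ ≤ MeanSquareMajorant.tau 3 (dd.1 * l₁) := by
    intro dd l₁
    simp only [hA]
    split_ifs
    · rw [norm_mul]
      calc ‖κ (dd.1 * l₁)‖ * ‖χ (l₁ : ZMod D)‖
          ≤ MeanSquareMajorant.tau 3 (dd.1 * l₁) * 1 :=
            mul_le_mul (hκ _) (DirichletCharacter.norm_le_one χ _)
              (norm_nonneg _) (MeanSquareMajorant.tau_nonneg _ _)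
        _ = _ := mul_one _
    · rw [norm_zero]; exact MeanSquareMajorant.tau_nonneg _ _
  have hBsupp : ∀ dd ∈ d.divisorsAntidiagonal, ∀ l₂ : ℕ, N ≤ l₂ → B dd l₂ = 0 := by
    intro dd hdd l₂ hl₂
    obtain ⟨hprod, hd0⟩ := Nat.mem_divisorsAntidiagonal.mp hdd
    have hd2 : 0 < dd.2 := Nat.pos_of_ne_zero fun h => hd0 (by rw [← hprod, h, mul_zero])
    have hn : N ≤ dd.2 * l₂ := le_trans hl₂ (Nat.le_mul_of_pos_left l₂ hd2)
    simp only [hB]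
    split_ifs <;> simp [hN _ hn]
  have hΔ : ∀ q : ℕ × ℕ, 0 < q.1 → 0 < q.2 →
      ‖DeltaW D (((q.1 * q.2 : ℕ) : ℝ) / R)‖ ≤ CΔ * R ^ 2 / (q.1 : ℝ) ^ 2 := by
    intro q h1 h2
    have hx : (0 : ℝ) < ((q.1 * q.2 : ℕ) : ℝ) / R := by positivity
    have hq1 : (0 : ℝ) < q.1 := by exact_mod_cast h1
    have hq12 : (q.1 : ℝ) ^ 2 ≤ (((q.1 * q.2 : ℕ) : ℝ)) ^ 2 := by
      push_cast
      exact pow_le_pow_left₀ hq1.le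
        (le_mul_of_one_le_right hq1.le (by exact_mod_cast h2)) 2
    calc ‖DeltaW D (((q.1 * q.2 : ℕ) : ℝ) / R)‖ ≤ CΔ / ((((q.1 * q.2 : ℕ) : ℝ)) / R) ^ 2 := hCΔ _ hx
      _ = CΔ * R ^ 2 / (((q.1 * q.2 : ℕ) : ℝ)) ^ 2 := by
          rw [div_pow, div_div_eq_mul_div]
      _ ≤ CΔ * R ^ 2 / (q.1 : ℝ) ^ 2 :=
          div_le_div_of_nonneg_left (by positivity) (by positivity) hq12
  -- the majorant `v(l₁)·|B(l₂)|`
  have hgn : ∀ dd (q : ℕ × ℕ), ‖g dd q‖ ≤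
      MeanSquareMajorant.tau 3 (dd.1 * q.1) / (q.1 : ℝ) ^ 2 * (CΔ * R ^ 2) * ‖B dd q.2‖ := by
    intro dd q
    have hnn : 0 ≤ MeanSquareMajorant.tau 3 (dd.1 * q.1) / (q.1 : ℝ) ^ 2 * (CΔ * R ^ 2) * ‖B dd q.2‖ :=
      mul_nonneg (mul_nonneg (div_nonneg (MeanSquareMajorant.tau_nonneg _ _) (sq_nonneg _))
        (by positivity)) (norm_nonneg _)
    rcases Nat.eq_zero_or_pos q.1 with h1 | h1
    · rw [hg0 dd q (Or.inl h1), norm_zero]; exact hnn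
    rcases Nat.eq_zero_or_pos q.2 with h2 | h2
    · rw [hg0 dd q (Or.inr h2), norm_zero]; exact hnn
    simp only [hg]
    rw [norm_mul, norm_mul]
    have hq1 : (0 : ℝ) < (q.1 : ℝ) ^ 2 := by positivity
    calc ‖A dd q.1‖ * ‖B dd q.2‖ * ‖DeltaW D (((q.1 * q.2 : ℕ) : ℝ) / R)‖
        ≤ MeanSquareMajorant.tau 3 (dd.1 * q.1) * ‖B dd q.2‖ * (CΔ * R ^ 2 / (q.1 : ℝ) ^ 2) :=
          mul_le_mul (mul_le_mul_of_nonneg_right (hAn dd q.1) (norm_nonneg _)) (hΔ q h1 h2)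
            (norm_nonneg _) (mul_nonneg (MeanSquareMajorant.tau_nonneg _ _) (norm_nonneg _))
      _ = _ := by field_simp
  have hv : ∀ dd ∈ d.divisorsAntidiagonal, Summable fun l₁ : ℕ =>
      MeanSquareMajorant.tau 3 (dd.1 * l₁) / (l₁ : ℝ) ^ 2 * (CΔ * R ^ 2) := by
    intro dd hdd
    obtain ⟨hprod, hd0⟩ := Nat.mem_divisorsAntidiagonal.mp hdd
    have hd1 : 0 < dd.1 := Nat.pos_of_ne_zero fun h => hd0 (by rw [← hprod, h, zero_mul])
    exact (summable_tau_three_mul_div_sq hd1).mul_right _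
  have hu : ∀ dd ∈ d.divisorsAntidiagonal, Summable fun l₂ : ℕ => ‖B dd l₂‖ := fun dd hdd =>
    summable_of_ne_finset_zero (s := Finset.range N) fun l₂ hl₂ => by
      rw [Finset.mem_range, not_lt] at hl₂
      rw [hBsupp dd hdd l₂ hl₂, norm_zero]
  -- summability over `ℕ × ℕ` and in `l₁` for fixed `l₂`
  have hgs : ∀ dd ∈ d.divisorsAntidiagonal, Summable (g dd) := fun dd hdd =>
    Summable.of_norm_bounded ((hv dd hdd).mul_of_nonneg (hu dd hdd)
      (fun l₁ => mul_nonneg (div_nonneg (MeanSquareMajorant.tau_nonneg _ _) (sq_nonneg _))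
        (by positivity)) (fun l₂ => norm_nonneg _)) (fun q => hgn dd q)
  have hgs1 : ∀ dd ∈ d.divisorsAntidiagonal, ∀ l₂ : ℕ, Summable fun l₁ : ℕ => g dd (l₁, l₂) :=
    fun dd hdd l₂ => Summable.of_norm_bounded ((hv dd hdd).mul_right ‖B dd l₂‖)
      (fun l₁ => hgn dd (l₁, l₂))
  -- grouped by the product `l = l₁l₂`
  have hfib : ∀ dd ∈ d.divisorsAntidiagonal,
      HasSum (fun l : ℕ => ∑ q ∈ l.divisorsAntidiagonal, g dd q) (∑' q : ℕ × ℕ, g dd q) :=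
    fun dd hdd => hasSum_sum_divisorsAntidiagonal (hgs dd hdd) (hg0 dd)
  -- the left side, term by term (the (7.17) regrouping of the convolution at `dl`)
  have hstep1 : ∀ l : ℕ, (if Nat.Coprime l k then
        MeanSquareMajorant.conv κ b (d * l) * χ (l : ZMod D) * DeltaW D ((l : ℝ) / R) else 0) =
      ∑ dd ∈ d.divisorsAntidiagonal, ∑ q ∈ l.divisorsAntidiagonal, g dd q := by
    intro l
    rcases Nat.eq_zero_or_pos l with rfl | hl
    · have h0 : MeanSquareMajorant.conv κ b 0 = 0 := by
        simp only [MeanSquareMajorant.conv, Nat.divisorsAntidiagonal_zero, Finset.sum_empty]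
      simp [h0, Nat.divisorsAntidiagonal_zero]
    · rw [MeanSquareMajorant.conv,
        Typed.Section15A.sum_divisorsAntidiagonal_mul_regroup (fun n => κ n) b hd hl]
      by_cases hc : Nat.Coprime l k
      · rw [if_pos hc, Finset.sum_mul, Finset.sum_mul]
        refine Finset.sum_congr rfl fun dd _ => ?_
        rw [Finset.sum_mul, Finset.sum_mul, Finset.sum_filter]
        refine Finset.sum_congr rfl fun q hq => ?_
        obtain ⟨hq1, _⟩ := Nat.mem_divisorsAntidiagonal.mp hq
        have hcl : Nat.Coprime (q.1 * q.2) k := by rw [hq1]; exact hc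
        have hc1 : Nat.Coprime q.1 k := Nat.Coprime.coprime_mul_right hcl
        have hc2 : Nat.Coprime q.2 k := Nat.Coprime.coprime_mul_left hcl
        simp only [hg, hA, hB]
        by_cases hcd : Nat.Coprime q.1 dd.2
        · have hA' : Nat.Coprime q.1 (dd.2 * k) := Nat.Coprime.mul_right hcd hc1
          rw [if_pos hcd, if_pos hA', if_pos hc2, ← hq1]
          push_cast
          rw [map_mul χ]
          ring
        · have hA' : ¬ Nat.Coprime q.1 (dd.2 * k) := fun h =>
            hcd (Nat.Coprime.coprime_mul_right_right h)
          rw [if_neg hcd, if_neg hA']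
          simp
      · rw [if_neg hc]
        symm
        refine Finset.sum_eq_zero fun dd _ => Finset.sum_eq_zero fun q hq => ?_
        obtain ⟨hq1, _⟩ := Nat.mem_divisorsAntidiagonal.mp hq
        simp only [hg, hA, hB]
        by_cases h1 : Nat.Coprime q.1 k
        · have h2 : ¬ Nat.Coprime q.2 k := fun h2 => hc (by rw [← hq1]; exact Nat.Coprime.mul_left h1 h2)
          rw [if_neg h2]
          simp
        · have hA' : ¬ Nat.Coprime q.1 (dd.2 * k) := fun h =>
            h1 (Nat.Coprime.coprime_mul_left_right h)
          rw [if_neg hA']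
          simp
  -- assemble
  have hsumm : ∀ dd ∈ d.divisorsAntidiagonal,
      Summable fun l : ℕ => ∑ q ∈ l.divisorsAntidiagonal, g dd q :=
    fun dd hdd => (hfib dd hdd).summable
  calc (∑' l : ℕ, if Nat.Coprime l k then
          MeanSquareMajorant.conv κ b (d * l) * χ (l : ZMod D) * DeltaW D ((l : ℝ) / R) else 0)
      = ∑' l : ℕ, ∑ dd ∈ d.divisorsAntidiagonal, ∑ q ∈ l.divisorsAntidiagonal, g dd q :=
        tsum_congr hstep1
    _ = ∑ dd ∈ d.divisorsAntidiagonal, ∑' l : ℕ, ∑ q ∈ l.divisorsAntidiagonal, g dd q :=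
        Summable.tsum_finsetSum hsumm
    _ = ∑ dd ∈ d.divisorsAntidiagonal, ∑' q : ℕ × ℕ, g dd q :=
        Finset.sum_congr rfl fun dd hdd => (hfib dd hdd).tsum_eq
    _ = ∑ dd ∈ d.divisorsAntidiagonal, ∑' l₂ : ℕ, ∑' l₁ : ℕ, g dd (l₁, l₂) :=
        Finset.sum_congr rfl fun dd hdd => by
          have e1 := (Equiv.prodComm ℕ ℕ).tsum_eq (g dd)
          simp only [Equiv.prodComm_apply] at e1
          rw [← e1]
          have hs' : Summable fun c : ℕ × ℕ => g dd c.swap :=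
            (Equiv.prodComm ℕ ℕ).summable_iff.mpr (hgs dd hdd)
          rw [Summable.tsum_prod' hs' (fun l₂ => by simpa using hgs1 dd hdd l₂)]
          simp
    _ = ∑ dd ∈ d.divisorsAntidiagonal, ∑' l₂ : ℕ, if Nat.Coprime l₂ k then
          b (dd.2 * l₂) * χ (l₂ : ZMod D) *
            ∑' l₁ : ℕ, (if Nat.Coprime l₁ (dd.2 * k) then
              κ (dd.1 * l₁) * χ (l₁ : ZMod D) * DeltaW D (((l₁ * l₂ : ℕ) : ℝ) / R)
            else 0)
        else 0 := by
        refine Finset.sum_congr rfl fun dd _ => tsum_congr fun l₂ => ?_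
        have hre : ∀ l₁ : ℕ, g dd (l₁, l₂) =
            B dd l₂ * (A dd l₁ * DeltaW D (((l₁ * l₂ : ℕ) : ℝ) / R)) := fun l₁ => by
          simp only [hg]; ring
        simp_rw [hre]
        rw [tsum_mul_left]
        simp only [hB, hA]
        by_cases hc2 : Nat.Coprime l₂ k
        · rw [if_pos hc2, if_pos hc2]
          congr 1
          refine tsum_congr fun l₁ => ?_
          split_ifs <;> simp
        · rw [if_neg hc2, if_neg hc2, zero_mul]

/-- `⌈e¹⁰⌉ ≤ D` gives `𝓛 = log D ≥ 10` (and so `D ≥ 3`). [cite: Zhang2022LandauSiegel, §2 p. 4] -/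
private theorem ten_le_ell_of_le {D : ℕ} (hD : ⌈Real.exp 10⌉₊ ≤ D) : 10 ≤ ell D := by
  have h : Real.exp 10 ≤ D := le_trans (Nat.le_ceil _) (by exact_mod_cast hD)
  exact (Real.le_log_iff_exp_le (lt_of_lt_of_le (Real.exp_pos _) h)).mpr h

/-- `⌈e¹⁰⌉ ≤ D` gives `3 ≤ D`. [folklore] -/
private theorem three_le_of_le {D : ℕ} (hD : ⌈Real.exp 10⌉₊ ≤ D) : 3 ≤ D := by
  have h : Real.exp 10 ≤ D := le_trans (Nat.le_ceil _) (by exact_mod_cast hD)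
  have h1 : (1 : ℝ) + 10 ≤ Real.exp 10 := Real.add_one_le_exp 10 |>.trans_eq' (by ring)
  have h3 : (3 : ℝ) ≤ D := by linarith
  exact_mod_cast h3

/-- **`Z22:§16.u011` DISCHARGED** (`D ≥ ⌈e¹⁰⌉`, every `p ∼ P`, `d, k ≥ 1`): "Similar to (7.17),
`Σ_{(l,k)=1}(κ₂∗b₁)(dl)χ(l)Δ(l/(Dpk)) = Σ_{d=d₁d₂} Σ_{(l₂,k)=1} b₁(d₂l₂)χ(l₂) Σ_{(l₁,d₂k)=1}
κ₂(d₁l₁)χ(l₁)Δ(l₁l₂/(Dpk))`" — the generic regrouping `tsum_conv_mul_DeltaW_regroup` at `κ = κ₂`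
(`|κ₂| ≤ τ₃`), `b = b₁` (finite support below `2PT⁻⁸ ≤ P`, `𝓛 ≥ 10`), `R = Dpk`; the `l₂`-series is
the printed finite sum over `1 ≤ l₂ < ⌈P⌉` by that support bound.
[cite: Zhang2022LandauSiegel, §16 p.89 (u011)] -/
theorem step16_u011_holds (c' : ℝ) : Step16_u011 c' := by
  refine ⟨⌈Real.exp 10⌉₊, fun D _ χ hD _ _ => ?_⟩
  intro p hp d k hd hk
  have hℓ : 10 ≤ ell D := ten_le_ell_of_le hD
  have hD3 : 3 ≤ D := three_le_of_le hD
  have hp0 : 0 < p := (Finset.mem_filter.mp hp).2.pos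
  have hD0 : 0 < D := by omega
  have hd0 : 0 < d := hd
  have hR0 : 0 < (D : ℝ) * p * k := by
    have hk0 : 0 < k := hk
    positivity
  -- support of `b₁`
  have hb0 : b1coef c' χ 0 = 0 := by
    unfold b1coef
    rw [Nat.divisorsAntidiagonal_zero, Finset.sum_empty]
  have hsupp : ∀ n : ℕ, ⌈bigP D⌉₊ ≤ n → b1coef c' χ n = 0 := fun n hn =>
    Typed.Section16ALeaves.b1coef_eq_zero_of_le c' χ
      ((Typed.Section16ALeaves.suppBound_le_bigP hℓ).trans
        (le_trans (Nat.le_ceil _) (by exact_mod_cast hn)))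
  have key := tsum_conv_mul_DeltaW_regroup hD3 χ (kappa2 c' D) (norm_kappa2_le_tau_three c' D)
    (b1coef c' χ) hb0 hsupp hR0 hd0 k
  unfold kappa2Star
  rw [key]
  refine Finset.sum_congr rfl fun e he => ?_
  obtain ⟨hprod, hd0'⟩ := Nat.mem_divisorsAntidiagonal.mp he
  have he2 : 0 < e.2 := Nat.pos_of_ne_zero fun h => hd0' (by rw [← hprod, h, mul_zero])
  rw [Finset.sum_filter, tsum_eq_sum (s := Finset.Ico 1 ⌈bigP D⌉₊)]
  intro l₂ hl₂
  rcases Nat.eq_zero_or_pos l₂ with rfl | hl₂0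
  · simp [hb0]
  · have hge : ⌈bigP D⌉₊ ≤ l₂ := by
      by_contra hlt
      exact hl₂ (Finset.mem_Ico.mpr ⟨hl₂0, not_le.mp hlt⟩)
    have hz : b1coef c' χ (e.2 * l₂) = 0 :=
      hsupp _ (le_trans hge (Nat.le_mul_of_pos_left l₂ he2))
    simp [hz]

variable (c' : ℝ) in
/-- `Step16_u011` — `_holds` alias of `step16_u011_holds` above under the fact's exact name, stated under the
prover's own binders as section variables (appended 2026-08-28, D-0026 bookkeeping: the proof term is the
existing theorem of this file; no statement, definition or attribute is edited; no new named fact; the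
ledger's debt table listed the fact unproved). [cite: Zhang2022LandauSiegel, §16 p.89 (u011)] -/
theorem _root_.Literature.NumberTheory.LFunctions.Zhang2022.Typed.Section16A.Step16_u011_holds :
    _root_.Literature.NumberTheory.LFunctions.Zhang2022.Typed.Section16A.Step16_u011 c' :=
  _root_.Literature.NumberTheory.LFunctions.Zhang2022.Typed.Section16A.step16_u011_holds (c' := c')

end U011

end Literature.NumberTheory.LFunctions.Zhang2022.Typed.Section16A
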